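import Summits.AtomisticToContinuum.Crystallization.Theorems.FrustratedLawDichotomyStrainedPatchKernelCut

/-!
# Strained patch — «ConeAnatomy»: the pair refinement (D_GB⋆) cut into  INTRINSIC GB-LAW over a hull family ∧ GB-SHADOW of the hull by the record family

decomp-a2c lens-5 g87 NODE (crux `AperiodicFrustratedLawGap`, stmt-AtomisticToContinuum-27623, T-side [CORE-FAR] `CoreOffTubeFloor (63/10) (63/10) ρ ε 0`,
route (F) `ρ = 26/5`; lens «finite/base range + asymptotic regime + bridge»).  Imports the landed g86 node `…StrainedPatchKernelCut` (p854118/p854121; it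
imports g85 `…SoftSplit`, the pair-tube records `…PairTube*` and the T26 consumer of record p854049).

THE LEAF.  The undecided analytic far T-leaf of record is the PAIR REFINEMENT (D_GB⋆) `RefineGBRecByAt 𝓘₀ 𝓘 ρ ε βf sf` = `RefineGB 𝓘₀ 𝓘 ρ ε (1/8) (1/25)
(constTol (1/25)) (1/25) (constTol (1/25)) (relConeBy 2 βf sf (1/25))`: every admissible clean mono-phase far-class cluster, `1/25`-charted by a host of the
coarse family `𝓘₀`, is (modulo an isometry) GB-charted by a host of the RECORD family `𝓘` — the finite host list whose tubes the E-side certifies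
(`TubeFloorGBRecBy 𝓘 βf sf`) — at the record cone.  As typed, the law is a statement about the GRID `𝓘`: its cone `β + s·ℓ` has to absorb BOTH the
cluster's intrinsic non-affinity (w.r.t. its best-fitting strained/bent host) AND the mismatch between that best host and the nearest member of `𝓘`
(strain grid ⇒ a pure slope `‖ΔA‖·ℓ`, lemma `dist_affine_pair_le`; bend grid ⇒ a slope GROWING with host radius, lemma `norm_quad_diff_le` — the
kinematic half of the rim obstruction BEND-86).

THE CUT (two pieces, seam = two triangle inequalities; the pair-currency form of the tree's graded SHADOW device `…CoverBridge.Shadows`, which carries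
site tables only and therefore cannot move a pair cone):
* (N) `RefineGB 𝓘₀ 𝓗 ρ ε η₂ τ₀ T₀ τ T B` — the INTRINSIC GB-law: refinement into an intermediate / hull family `𝓗` (all strains and bends of the window,
  not a grid) at the intrinsic tables `(τ, T, B)`.  [ANALYTIC · UNDECIDED · EMPIRICAL at `τ₀ = 1/25` · INSTRUMENTABLE «INTR-87»: the witness library's cones
  w.r.t. least-squares hosts.]  WEAKER than (D_GB⋆) for `𝓗 ⊇ 𝓘` at equal tables (`RefineGB.mono`); at the tighter intrinsic cone it is the grid-free
  core of the law and does not give (D_GB⋆) without (F) (probe MustFail87 (i)).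
* (F) `ShadowsGB 𝓗 𝓘 τ τ₁ T T₁ B B₁` — the GB-SHADOW: every hull host has a record host ON THE SAME LABELS whose site and PAIR tables at the record data
  dominate the hull tables plus the host-to-host deviations, and whose `(63/10 − τ₁)`-ball lies inside the hull host's `(63/10 − τ)`-ball.
  [KINEMATIC · ATTACKABLE (designed grids: arithmetic of `dist_affine_pair_le` / `norm_quad_diff_le`) · INSTRUMENTABLE «NET-87» (the census's actual host
  list against its hull).]  Mentions no cluster, no admissibility, no energy: does not give (D_GB⋆) without (N) (probe MustFail87 (ii)); with the pair
  clause deleted (the tree's `Shadows`) the seam breaks (probe MustFail87 (iii)).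
* SEAM `RefineGB.shadow : (N) → (F) → RefineGB 𝓘₀ 𝓘 ρ ε η₂ τ₀ T₀ τ₁ T₁ B₁` (§2), records §3 (route (F) `ρ = 26/5`, any `(ρ, ε)` in hull currency, the crux BY
  NAME through p854049, and the composition with g86's kernel cut run over the hull).  The same device read on the E-side (`tubeFloorGB_shadow`: record
  cells ∧ (F) ⟹ hull cells) lets EITHER side of the junction pay the exchange rate (F); §3 `coreOff_of_shadow_of_coarse_of_refineGB`.

WHY (memo NODE-g87 §2–§4, finding BASIN-87).  In tree units (`lennardJones r = r⁻¹²/12 − r⁻⁶/6`, host bonds `≈ 0.97`, `V'' ≈ 11`, `|V'''| ≈ 214`,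
`σ₁ = 8892/7⁷ ≈ 0.0108`) the one-step Taylor basin of every constant-tracking closure of (N) (LP rows of g86 (P), Newton–Kantorovich, discrete
Cordes / Hildebrandt–Widman / Krylov–Safonov) is a bond-oscillation `≲ 0.010–0.017`, while the `1/25` site boxes allow `0.08` and the record nn-cones are
`0.020–0.031`: the dimensionless anharmonicity `𝔞 = osc·|V'''|/(2λ) ≈ 1.6–3.9 > 1`.  So at `τ₀ = 1/25` the intrinsic law (N) is an EMPIRICAL near-equality,
provable by perturbation iff the discriminant test DISC-87 (§5 `basin_iff_disc`, pre-registered on the census instrument KERNEL-86) reads `4·A·c ≤ 1` AND a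
start below the larger root is available — neither is in hand.  What IS decidable now is the anatomy: which part of the record cone is grid (F) and which is
physics (N); (F) is the part the H/T junction can renegotiate (finer host list ⇔ tighter T-law at fixed E-cost per host), (N) is the analytic floor.

Contents: §0 `HostShadowGB` / `ShadowsGB` (+ `refl`, `of_familyLE`, `trans`, ↦ `Shadows`) · §1 chart transfer `chartByGB_of_hostShadowGB` · §2 family seams
(`FamilyCoverGB`, `TubeFloorGB`, `RefineGB`, `RefineGBAlong`) · §3 records + crux by name · §4 anatomy lemmas (affine / quadratic host differences) · §5 the basin
toy `basin_iff_disc`.  0 sorry; standard axioms.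
-/

open scoped BigOperators Classical
open Summit.AtomisticToContinuum.Crystallization.Theorems.ChargedEnergyGapNegative (eStar E3)
open Summit.AtomisticToContinuum.Crystallization.Theorems.FrustratedLawDichotomyRangeCut
open Summit.AtomisticToContinuum.Crystallization.Theorems.FrustratedLawDichotomySchurCut
open Summit.AtomisticToContinuum.Crystallization.Theorems.FrustratedLawDichotomyMotifLemmas (GoodAtScale)
open Summit.AtomisticToContinuum.Crystallization.Theorems.FrustratedLawDichotomyAveragingCut (ballAvg)
open Summit.AtomisticToContinuum.Crystallization.Theorems.FrustratedLawDichotomyExemptLocOpt (LocOptFails)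
open Summit.AtomisticToContinuum.Crystallization.Theorems.FrustratedLawDichotomyExemptSplit (SchurElasticPricingX)
open Summit.AtomisticToContinuum.Crystallization.Theorems.FrustratedLawDichotomyExemptAbsorptionRecord
open Summit.AtomisticToContinuum.Crystallization.Theorems.FrustratedLawDichotomyCollarCensus
open Summit.AtomisticToContinuum.Crystallization.Theorems.FrustratedLawDichotomyCollarCensusKappa
open Summit.AtomisticToContinuum.Crystallization.Theorems.FrustratedLawDichotomyStrainedPatchHomSplit
open Summit.AtomisticToContinuum.Crystallization.Theorems.FrustratedLawDichotomyStrainedPatchCleanCollar (CleanBall TailPenalty AnnularDefectFloor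
  DefectiveCollarFloor tailOut)
open Summit.AtomisticToContinuum.Crystallization.Theorems.FrustratedLawDichotomyStrainedPatchPhaseCut (MonoPhaseBall AnnularPhaseFloor PolyTextureFloor
  monoPhaseBall_comp_iff)
open Summit.AtomisticToContinuum.Crystallization.Theorems.FrustratedLawDichotomyStrainedPatchCoreTube (NearHomIsoAt CoreOffTubeFloor nearHomIsoAt_comp_iff)
open Summit.AtomisticToContinuum.Crystallization.Theorems.FrustratedLawDichotomyStrainedPatchCoreTubeRecord (CoreCoreRelief)
open Summit.AtomisticToContinuum.Crystallization.Theorems.FrustratedLawDichotomyStrainedPatchHomIsometry (admissible_comp_iff goodAtScale_comp_iff)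
open Summit.AtomisticToContinuum.Crystallization.Theorems.FrustratedLawDichotomyStrainedPatchHomTubeIso (cleanBall_comp_iff)
open Summit.AtomisticToContinuum.Crystallization.Theorems.FrustratedLawDichotomyStrainedPatchChartFamilies (ChartBy FamilyLE familyLE_refl)
open Summit.AtomisticToContinuum.Crystallization.Theorems.FrustratedLawDichotomyStrainedPatchQuantSlaving (ChartFam SlackTab HessTab ForceTab)
open Summit.AtomisticToContinuum.Crystallization.Theorems.FrustratedLawDichotomyStrainedPatchGradedTube
open Summit.AtomisticToContinuum.Crystallization.Theorems.FrustratedLawDichotomyStrainedPatchCoverBridge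
open Summit.AtomisticToContinuum.Crystallization.Theorems.FrustratedLawDichotomyStrainedPatchPairTube
open Summit.AtomisticToContinuum.Crystallization.Theorems.FrustratedLawDichotomyStrainedPatchHomCertTree (CertTree treeOK)
open Summit.AtomisticToContinuum.Crystallization.Theorems.FrustratedLawDichotomyStrainedPatchHomEntryGram (rootC rootW)
open Summit.AtomisticToContinuum.Crystallization.Theorems.FrustratedLawDichotomyStrainedPatchHomEntryGramHcp (rootCH rootWH)
open Summit.AtomisticToContinuum.Crystallization.Theorems.FrustratedLawDichotomyStrainedPatchHomEntryLeafHT (entryLeafOK6RBKP4 semOKH)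
open Summit.AtomisticToContinuum.Crystallization.Theorems.FrustratedLawDichotomyAperiodicGapRecordJunctionHomFloorF6pT26
open Summit.AtomisticToContinuum.Crystallization.Theorems.FrustratedLawDichotomyStrainedPatchKernelCut

namespace Summit.AtomisticToContinuum.Crystallization.Theorems.FrustratedLawDichotomyStrainedPatchConeAnatomy

/-! ## §0. Shadows in pair currency -/

/-- `HostShadowGB τ τ₀ T T₀ B B₀ z₁ z₀ c₁` — the host `z₀` (SAME index type, SAME centre index) GB-shadows the host `z₁` charted at `(τ, T, B)` when read at
`(τ₀, T₀, B₀)`: at every site of `z₁` within `63/10 + τ` of its centre the positions relative to the centres agree within the slacks `τ₀ − τ` and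
`T₀(z₀) b − T(z₁) b`; for every two such sites the relative position `z a − z b` agrees within the PAIR slack `B₀(z₀)(a,b) − B(z₁)(a,b)`; and the shadow's
`(63/10 − τ₀)`-ball lies inside the host's `(63/10 − τ)`-ball. -/
def HostShadowGB (τ τ₀ : ℝ) (T T₀ : SlackTab) (B B₀ : PairTab) {M₁ : ℕ} (z₁ z₀ : Fin M₁ → E3) (c₁ : Fin M₁) : Prop :=
  (∀ b, dist (z₁ b) (z₁ c₁) ≤ 63 / 10 + τ →
      dist (z₁ b - z₁ c₁) (z₀ b - z₀ c₁) ≤ τ₀ - τ ∧ dist (z₁ b - z₁ c₁) (z₀ b - z₀ c₁) ≤ T₀ M₁ z₀ c₁ b - T M₁ z₁ c₁ b) ∧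
  (∀ a b, dist (z₁ a) (z₁ c₁) ≤ 63 / 10 + τ → dist (z₁ b) (z₁ c₁) ≤ 63 / 10 + τ →
      dist (z₁ a - z₁ b) (z₀ a - z₀ b) ≤ B₀ M₁ z₀ c₁ a b - B M₁ z₁ c₁ a b) ∧
  (∀ b, dist (z₀ b) (z₀ c₁) ≤ 63 / 10 - τ₀ → dist (z₁ b) (z₁ c₁) ≤ 63 / 10 - τ)

/-- (piece) [route statement · this cell; NOT a literature fact] ★★ **(F) `ShadowsGB 𝓘 𝓘₀ τ τ₀ T T₀ B B₀` [KINEMATIC · ATTACKABLE / INSTRUMENTABLE «NET-87»]** —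
every host of `𝓘` is GB-shadowed by a host of `𝓘₀`.  (Readings: a HULL family shadowed by the finite RECORD family — the T-law's grid slack; a bent family
by its affine parts; a fine net by a coarse one.  `Shadows` of the tree = the same with the pair clause dropped.) -/
def ShadowsGB (𝓘 𝓘₀ : ChartFam) (τ τ₀ : ℝ) (T T₀ : SlackTab) (B B₀ : PairTab) : Prop :=
  ∀ (M₁ : ℕ) (z₁ : Fin M₁ → E3) (c₁ : Fin M₁), 𝓘 M₁ z₁ c₁ → ∃ z₀ : Fin M₁ → E3, 𝓘₀ M₁ z₀ c₁ ∧ HostShadowGB τ τ₀ T T₀ B B₀ z₁ z₀ c₁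

section Shadow

variable {𝓘 𝓘₀ 𝓘₂ 𝓝 𝓗 : ChartFam} {ρ ε η₂ τ τ₀ τ₂ : ℝ} {T T₀ T₂ : SlackTab} {B B₀ B₂ : PairTab} {M : ℕ} {z : Fin M → E3} {c : Fin M} {M₁ : ℕ}
  {z₁ z₀ z₂ : Fin M₁ → E3} {c₁ : Fin M₁} {e : Fin M → Fin M₁}

/-- `‖v‖ ≤ r + s` from `‖u‖ ≤ r` and `dist u v ≤ s` (lane docstring, hand-2 g39). -/
private theorem norm_le_add_of_dist_le {u v : E3} {r s : ℝ} (hu : ‖u‖ ≤ r) (h : dist u v ≤ s) : ‖v‖ ≤ r + s := by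
  rw [dist_eq_norm] at h
  calc ‖v‖ = ‖u - (u - v)‖ := by rw [sub_sub_cancel]
    _ ≤ ‖u‖ + ‖u - v‖ := norm_sub_le _ _
    _ ≤ r + s := add_le_add hu h

/-- The graded shadow underlies the GB-shadow. [formal bookkeeping] -/
theorem ShadowsGB.shadows (h : ShadowsGB 𝓘 𝓘₀ τ τ₀ T T₀ B B₀) : Shadows 𝓘 𝓘₀ τ τ₀ T T₀ := fun M₁ z₁ c₁ hI =>
  let ⟨z₀, h₀, hs⟩ := h M₁ z₁ c₁ hI
  ⟨z₀, h₀, hs.1, hs.2.2⟩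

/-- A host shadows itself at any dominating data. [formal bookkeeping] -/
theorem hostShadowGB_self (hτ : τ ≤ τ₀) (hT : ∀ b, T M₁ z₁ c₁ b ≤ T₀ M₁ z₁ c₁ b) (hB : ∀ a b, B M₁ z₁ c₁ a b ≤ B₀ M₁ z₁ c₁ a b) :
    HostShadowGB τ τ₀ T T₀ B B₀ z₁ z₁ c₁ :=
  ⟨fun b _ => by rw [dist_self]; exact ⟨by linarith, by linarith [hT b]⟩, fun a b _ _ => by rw [dist_self]; linarith [hB a b],
    fun b hb => by linarith⟩

/-- ★ Family inclusion with dominated data is the DEVIATION-FREE GB-shadow — so `RefineGB.mono` / `FamilyCoverGB.mono_*` are the `ShadowsGB` seams at zero slack.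
[formal bookkeeping] -/
theorem shadowsGB_of_familyLE (h : FamilyLE 𝓘 𝓘₀) (hτ : τ ≤ τ₀) (hT : TolLE T T₀) (hB : PairLE B B₀) : ShadowsGB 𝓘 𝓘₀ τ τ₀ T T₀ B B₀ :=
  fun M₁ z₁ c₁ hI => ⟨z₁, h M₁ z₁ c₁ hI, hostShadowGB_self hτ (fun b => hT M₁ z₁ c₁ b) (fun a b => hB M₁ z₁ c₁ a b)⟩

/-- `shadowsGB_refl`. [formal bookkeeping] -/
theorem shadowsGB_refl (𝓘 : ChartFam) (τ : ℝ) (T : SlackTab) (B : PairTab) : ShadowsGB 𝓘 𝓘 τ τ T T B B :=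
  shadowsGB_of_familyLE (familyLE_refl 𝓘) le_rfl (TolLE.refl T) (fun _ _ _ _ _ => le_rfl)

/-- ★ GB-shadows COMPOSE (hull → coarse grid → fine grid; the exchange rates add). [folklore: triangle inequalities] -/
theorem HostShadowGB.trans (h₁ : HostShadowGB τ τ₀ T T₀ B B₀ z₁ z₀ c₁) (h₂ : HostShadowGB τ₀ τ₂ T₀ T₂ B₀ B₂ z₀ z₂ c₁) :
    HostShadowGB τ τ₂ T T₂ B B₂ z₁ z₂ c₁ := by
  obtain ⟨hd₁, hp₁, hb₁⟩ := h₁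
  obtain ⟨hd₂, hp₂, hb₂⟩ := h₂
  have hR : ∀ b, dist (z₁ b) (z₁ c₁) ≤ 63 / 10 + τ → dist (z₀ b) (z₀ c₁) ≤ 63 / 10 + τ₀ := by
    intro b hb
    have h := (hd₁ b hb).1
    rw [dist_eq_norm] at hb ⊢
    linarith [norm_le_add_of_dist_le hb h]
  refine ⟨fun b hb => ?_, fun a b ha hb => ?_, fun b hb => hb₁ b (hb₂ b hb)⟩
  · have htri := dist_triangle (z₁ b - z₁ c₁) (z₀ b - z₀ c₁) (z₂ b - z₂ c₁)
    obtain ⟨h1, h2⟩ := hd₁ b hb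
    obtain ⟨h3, h4⟩ := hd₂ b (hR b hb)
    constructor <;> linarith
  · have htri := dist_triangle (z₁ a - z₁ b) (z₀ a - z₀ b) (z₂ a - z₂ b)
    have h1 := hp₁ a b ha hb
    have h2 := hp₂ a b (hR a ha) (hR b hb)
    linarith

/-- `ShadowsGB.trans`. [formal bookkeeping] -/
theorem ShadowsGB.trans (h₁ : ShadowsGB 𝓘 𝓘₀ τ τ₀ T T₀ B B₀) (h₂ : ShadowsGB 𝓘₀ 𝓘₂ τ₀ τ₂ T₀ T₂ B₀ B₂) : ShadowsGB 𝓘 𝓘₂ τ τ₂ T T₂ B B₂ := by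
  intro M₁ z₁ c₁ hI
  obtain ⟨z₀, h₀, hs₀⟩ := h₁ M₁ z₁ c₁ hI
  obtain ⟨z₂, h₂', hs₂⟩ := h₂ M₁ z₀ c₁ h₀
  exact ⟨z₂, h₂', hs₀.trans hs₂⟩

/-! ## §1. Chart transfer along a GB-shadow (same labelling) -/

/-- ★★ **GB-SHADOW TRANSFER**: a GB-chart by `z₁` at `(τ, T, B)` is a GB-chart by any GB-shadow `z₀ ∈ 𝓘₀` of `z₁` at `(τ₀, T₀, B₀)`, SAME labels — the site
clauses by one triangle inequality each (as `chartByG_shadow`), the PAIR clause by `‖(z a − z b) − (z₀ a − z₀ b)‖ ≤ ‖(z a − z b) − (z₁ a − z₁ b)‖ + ‖(z₁ a − z₁ b)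
− (z₀ a − z₀ b)‖ ≤ B(z₁) + (B₀(z₀) − B(z₁))`. [folklore] -/
theorem chartByGB_of_hostShadowGB (h : ChartByGB 𝓘 τ T B z c z₁ c₁ e) (h₀ : 𝓘₀ M₁ z₀ c₁) (hs : HostShadowGB τ τ₀ T T₀ B B₀ z₁ z₀ c₁) :
    ChartByGB 𝓘₀ τ₀ T₀ B₀ z c z₀ c₁ e := by
  have hR : ∀ a, dist (z a) (z c) ≤ 63 / 10 → dist (z₁ (e a)) (z₁ c₁) ≤ 63 / 10 + τ := fun a ha => ChartByG.host_dist_le h.1 ha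
  obtain ⟨⟨⟨-, hec, hco, -, hinj, hcov⟩, htab⟩, hpair⟩ := h
  obtain ⟨hdev, hpd, hball⟩ := hs
  have key : ∀ a, dist (z a) (z c) ≤ 63 / 10 →
      dist (z a - z c) (z₀ (e a) - z₀ c₁) ≤ τ₀ ∧ dist (z a - z c) (z₀ (e a) - z₀ c₁) ≤ T₀ M₁ z₀ c₁ (e a) := by
    intro a ha
    have htri := dist_triangle (z a - z c) (z₁ (e a) - z₁ c₁) (z₀ (e a) - z₀ c₁)
    have h1 := hco a ha
    have h2 := htab a ha
    obtain ⟨h3, h4⟩ := hdev (e a) (hR a ha)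
    constructor <;> linarith
  refine ⟨⟨⟨h₀, hec, fun a ha => (key a ha).1, fun a ha _ => (key a ha).1, hinj, fun b₀ hb₀ => hcov b₀ (hball b₀ hb₀)⟩,
    fun a ha => (key a ha).2⟩, fun a b ha hb => ?_⟩
  have htri := dist_triangle (z a - z b) (z₁ (e a) - z₁ (e b)) (z₀ (e a) - z₀ (e b))
  have h1 := hpair a b ha hb
  have h2 := hpd (e a) (e b) (hR a ha) (hR b hb)
  linarith

/-- The family form. [formal bookkeeping] -/
theorem chartByGB_shadow (hS : ShadowsGB 𝓘 𝓘₀ τ τ₀ T T₀ B B₀) (h : ChartByGB 𝓘 τ T B z c z₁ c₁ e) :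
    ∃ z₀ : Fin M₁ → E3, ChartByGB 𝓘₀ τ₀ T₀ B₀ z c z₀ c₁ e := by
  obtain ⟨z₀, h₀, hs⟩ := hS M₁ z₁ c₁ h.1.1.1
  exact ⟨z₀, chartByGB_of_hostShadowGB h h₀ hs⟩

/-! ## §2. The family seams: covers push forward, certificates pull back, refinements push forward -/

/-- A pair cover by a GB-shadowed family is a pair cover by the shadow family at the fattened data. [folklore] -/
theorem familyCoverGB_shadow (hS : ShadowsGB 𝓘 𝓘₀ τ τ₀ T T₀ B B₀) (h : FamilyCoverGB 𝓘 ρ ε η₂ τ T B) : FamilyCoverGB 𝓘₀ ρ ε η₂ τ₀ T₀ B₀ := by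
  intro M z c hz hcl hm hn hg
  obtain ⟨R, M₁, z₁, c₁, e, hch⟩ := h M z c hz hcl hm hn hg
  obtain ⟨z₀, hch₀⟩ := chartByGB_shadow hS hch
  exact ⟨R, M₁, z₀, c₁, e, hch₀⟩

/-- ★ THE NET READING in pair currency: pair-tube cells on the SHADOW family `𝓝` at the fattened data certify every host of the shadowed family at the tight
data — `ShadowsGB 𝓗 𝓝 τ τ₀ T T₀ B B₀ → (TF-GB)(𝓝, τ₀, T₀, B₀) → (TF-GB)(𝓗, τ, T, B)`.  (How a FINITE certified host list prices a CONTINUUM of hosts.) [folklore] -/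
theorem tubeFloorGB_shadow (hS : ShadowsGB 𝓗 𝓝 τ τ₀ T T₀ B B₀) (h : TubeFloorGB 𝓝 τ₀ T₀ B₀) : TubeFloorGB 𝓗 τ T B := by
  intro M z c M₁ z₁ c₁ e hz hcl hm hch
  obtain ⟨z₀, hch₀⟩ := chartByGB_shadow hS hch
  exact h M z c M₁ z₀ c₁ e hz hcl hm hch₀

/-- ★★ **THE SEAM: (N) ∧ (F) ⟹ (D_GB).**  A pair refinement into a GB-shadowed family `𝓗` is a pair refinement into the shadow family at the fattened data.
[folklore] -/
theorem RefineGB.shadow {𝓘c : ChartFam} {τc : ℝ} {Tc : SlackTab} (h : RefineGB 𝓘c 𝓗 ρ ε η₂ τc Tc τ T B) (hS : ShadowsGB 𝓗 𝓘₀ τ τ₀ T T₀ B B₀) :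
    RefineGB 𝓘c 𝓘₀ ρ ε η₂ τc Tc τ₀ T₀ B₀ := by
  intro M z c M₀ z₀ c₀ e hz hcl hm hn hg hch
  obtain ⟨R, M₁, z₁, c₁, e₁, hch₁⟩ := h M z c M₀ z₀ c₀ e hz hcl hm hn hg hch
  obtain ⟨z₂, hch₂⟩ := chartByGB_shadow hS hch₁
  exact ⟨R, M₁, z₂, c₁, e₁, hch₂⟩

/-- … label-preserving form. [formal bookkeeping] -/
theorem RefineGBAlong.shadow {𝓘c : ChartFam} {τc : ℝ} {Tc : SlackTab} (h : RefineGBAlong 𝓘c 𝓗 ρ ε η₂ τc Tc τ T B)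
    (hS : ShadowsGB 𝓗 𝓘₀ τ τ₀ T T₀ B B₀) : RefineGBAlong 𝓘c 𝓘₀ ρ ε η₂ τc Tc τ₀ T₀ B₀ := by
  intro M z c M₀ z₀ c₀ e hz hcl hm hn hg hch
  obtain ⟨R, z₁, hch₁⟩ := h M z c M₀ z₀ c₀ e hz hcl hm hn hg hch
  obtain ⟨z₂, hch₂⟩ := chartByGB_shadow hS hch₁
  exact ⟨R, z₂, hch₂⟩

/-- EXACTNESS at zero slack: `RefineGB.mono` is the seam along `shadowsGB_of_familyLE`. [formal bookkeeping] -/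
theorem refineGB_mono_via_shadow {𝓘c : ChartFam} {τc : ℝ} {Tc : SlackTab} (h : RefineGB 𝓘c 𝓗 ρ ε η₂ τc Tc τ T B) (h𝓘 : FamilyLE 𝓗 𝓘₀)
    (hT : TolLE T T₀) (hB : PairLE B B₀) (hτ : τ ≤ τ₀) : RefineGB 𝓘c 𝓘₀ ρ ε η₂ τc Tc τ₀ T₀ B₀ :=
  RefineGB.shadow h (shadowsGB_of_familyLE h𝓘 hτ hT hB)

/-- ★★ THE NODE at general data: hull cells by the net reading, the coarse cover, the intrinsic refinement ⟹ [CORE-FAR]`(ρ, ε)`. [folklore] -/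
theorem coreOff_of_shadow_of_coarse_of_refineGB {τc : ℝ} {Tc : SlackTab} (hT : TubeFloorGB 𝓝 τ₀ T₀ B₀) (hS : ShadowsGB 𝓗 𝓝 τ τ₀ T T₀ B B₀)
    (hK : FamilyCoverG 𝓘₀ ρ ε (1 / 8) τc Tc) (hD : RefineGB 𝓘₀ 𝓗 ρ ε (1 / 8) τc Tc τ T B) : CoreOffTubeFloor (63 / 10) (63 / 10) ρ ε 0 :=
  coreOff_of_tubeFloorGB_of_coarse_of_refineGB (tubeFloorGB_shadow hS hT) hK hD

end Shadow

/-! ## §3. Records (route (F) `ρ = 26/5`; the crux by name) -/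

section Record

variable {𝓘₀ 𝓘 𝓗 : ChartFam} {𝓑 : BalPred} {ρ ε τ τ₁ κ σ : ℝ} {T T₁ : SlackTab} {B : PairTab} {H : HessTab} {F : ForceTab} {X : SlackTab}
  {βf sf : (M₀ : ℕ) → (Fin M₀ → E3) → Fin M₀ → ℝ}

/-- ★★★ (D_GB⋆ by host at ρ, ε) ⟸ (N) the intrinsic GB-law over `𝓗` at `(τ, T, B)` ∧ (F) the GB-shadow of `𝓗` by the record family at the record table.
[folklore instantiation] -/
theorem refineGBRecByAt_of_intrinsic_of_shadow (hN : RefineGB 𝓘₀ 𝓗 ρ ε (1 / 8) (1 / 25) (constTol (1 / 25)) τ T B)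
    (hF : ShadowsGB 𝓗 𝓘 τ (1 / 25) T (constTol (1 / 25)) B (relConeBy 2 βf sf (1 / 25))) : RefineGBRecByAt 𝓘₀ 𝓘 ρ ε βf sf :=
  RefineGB.shadow hN hF

/-- ★★★ Route (F), `ρ = 26/5`: [CORE-FAR] from the host-graded E-cell of record, the record cover (K⋆), the intrinsic law and the shadow — through the tree's
`coreOff_26_5_of_pairTubeRecBy`. [folklore instantiation] -/
theorem coreOff_26_5_of_intrinsic_of_shadow (hT : TubeFloorGBRecBy 𝓘 βf sf) (hK : FamilyCoverGRecAt 𝓘₀ (26 / 5) (1 / 100))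
    (hN : RefineGB 𝓘₀ 𝓗 (26 / 5) (1 / 100) (1 / 8) (1 / 25) (constTol (1 / 25)) τ T B)
    (hF : ShadowsGB 𝓗 𝓘 τ (1 / 25) T (constTol (1 / 25)) B (relConeBy 2 βf sf (1 / 25))) : CoreOffTubeFloor (63 / 10) (63 / 10) (26 / 5) (1 / 100) 0 :=
  coreOff_26_5_of_pairTubeRecBy hT hK (refineGBRecByAt_of_intrinsic_of_shadow hN hF)

/-- ★ COMPOSITION WITH g86: the kernel cut run over the HULL family (balanced refit into `𝓗`, row enclosure and pair-kernel certificate on `𝓗`-charts at the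
intrinsic table) followed by the shadow gives (D_GB⋆) over the record family. [folklore instantiation] -/
theorem refineGBRecByAt_of_hullKernelCut_of_shadow (hR : BalancedRefit 𝓘₀ 𝓗 𝓑 ρ ε (1 / 8) (1 / 25) (constTol (1 / 25)) τ₁ T₁)
    (hE : SlavingEnclosureG 𝓗 𝓑 ρ ε (1 / 8) τ₁ T₁ κ σ H F X) (hP : PairKernelCert 𝓗 𝓑 τ₁ T₁ κ σ H F X τ T B)
    (hF : ShadowsGB 𝓗 𝓘 τ (1 / 25) T (constTol (1 / 25)) B (relConeBy 2 βf sf (1 / 25))) : RefineGBRecByAt 𝓘₀ 𝓘 ρ ε βf sf :=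
  refineGBRecByAt_of_intrinsic_of_shadow (refineGB_of_kernelCut hR hE hP) hF

/-- ★★★ **THE CRUX BY NAME on route (F₆′) at the (α)-switch literals (T26/μ₇₄)** through the landed consumer of record
`aperiodicFrustratedLawGap_of_entryTree6RBKP4_semOKH_fallbackLever_pairTube_A35000_T26_record` (p854049) with its T-leaf `hDf : RefineGBRecByAt 𝓘₀ 𝓘 (26/5) (1/100) βf sf`
REPLACED by (N) ∧ (F). [folklore instantiation] -/
theorem aperiodicFrustratedLawGap_of_entryTree6RBKP4_semOKH_fallbackLever_coneAnatomy_A35000_T26_record {εE CE DE DX : ℝ}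
    (hε0 : 0 < εE) (hε1 : εE ≤ 1 / 10000) (hDX : 0 ≤ DX)
    (hEl : SchurElasticPricingX (1 / 20) (1 / 8) w₄₅ ω₄ (3 / 400) (-(7175 / 10000)) (1 / 10000) CE DE DX (LocOptFails eStar εE (3 / 2) 1))
    (hFcc : ∃ t : CertTree (Fin 3 × Fin 3), treeOK (entryLeafOK6RBKP4 (-399210329969189)) t rootC rootW = true)
    (hHcp : semOKH (-399210329969189) rootCH rootWH = true)
    (hT : ∀ (M : ℕ) (z : Fin M → E3) (c : Fin M), Admissible M z c → CleanBall (63 / 10) z c → MonoPhaseBall (63 / 10) z c →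
      NearHomIsoAt (26 / 5) (1 / 100) z c → -(13 / 50000) ≤ ballAvg (9 / 5) z (tailOut (26 / 5) M z c) c)
    (hRl : CoreCoreRelief (63 / 10) (63 / 10) (26 / 5) (1 / 100) (3 / 5000))
    (hTB : TubeFloorGBRecBy 𝓘 βf sf) (hK : FamilyCoverGRecAt 𝓘₀ (26 / 5) (1 / 100))
    (hN : RefineGB 𝓘₀ 𝓗 (26 / 5) (1 / 100) (1 / 8) (1 / 25) (constTol (1 / 25)) τ T B)
    (hSh : ShadowsGB 𝓗 𝓘 τ (1 / 25) T (constTol (1 / 25)) B (relConeBy 2 βf sf (1 / 25)))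
    (hF : AnnularPhaseFloor (63 / 10) (24 / 5) (63 / 10) (1 / 1000)) (hP : PolyTextureFloor (63 / 10) (24 / 5) (1 / 1000))
    (hA : AnnularDefectFloor (24 / 5) (63 / 10)) (hD : DefectiveCollarFloor (24 / 5))
    (h2 : CrowdedCoreMotifPricingCapK (1 / 1000) (9 / 5) (133 / 10) (3 / 2) (effPot w₄₅ ω₄ (3 / 400)) (-(7175 / 10000) + 3 / 400)
      (Collar (9 / 2) fun N y j => (∃ s : ℝ, 0 ≤ s ∧ s ≤ 3 / 2 ∧ NonEquilibriumCore (-(7175 / 10000)) 0 7 s (1 / 10000) N y j) ∨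
        GoodAtScale (1 / 20) (3 / 2) y j))
    (h3 : DiluteDefectMotifPricingCapK (1 / 1000) (9 / 5) (133 / 10) (3 / 2) (effPot w₄₅ ω₄ (3 / 400)) (-(7175 / 10000) + 3 / 400)
      (Collar (9 / 2) fun N y j => (∃ s : ℝ, 0 ≤ s ∧ s ≤ 3 / 2 ∧ NonEquilibriumCore (-(7175 / 10000)) 0 7 s (1 / 10000) N y j) ∨
        GoodAtScale (1 / 20) (3 / 2) y j)) :
    Summit.AtomisticToContinuum.Crystallization.Theses.FrustratedLawDichotomy.AperiodicFrustratedLawGap :=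
  aperiodicFrustratedLawGap_of_entryTree6RBKP4_semOKH_fallbackLever_pairTube_A35000_T26_record hε0 hε1 hDX hEl hFcc hHcp hT hRl hTB hK
    (refineGBRecByAt_of_intrinsic_of_shadow hN hSh) hF hP hA hD h2 h3

end Record

/-! ## §4. Anatomy of the shadow slack: the strain grid is a pure cone, the bend grid grows with the host radius -/

section Anatomy

/-- ★ AFFINE host difference: the pair deviation between the images of a reference pair under two affine maps is at most `‖L − L₀‖·‖u − v‖` — a cone of ZERO
floor and slope the strain-grid step (in reference lengths): the `s·ℓ` part of the record cones. [folklore] -/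
theorem dist_affine_pair_le (L L₀ : E3 →L[ℝ] E3) (p p₀ u v : E3) :
    dist ((L u + p) - (L v + p)) ((L₀ u + p₀) - (L₀ v + p₀)) ≤ ‖L - L₀‖ * ‖u - v‖ := by
  have h : (L u + p) - (L v + p) - ((L₀ u + p₀) - (L₀ v + p₀)) = (L - L₀) (u - v) := by
    simp only [sub_apply, map_sub]
    abel
  rw [dist_eq_norm, h]
  exact ContinuousLinearMap.le_opNorm _ _

/-- ★ QUADRATIC (bend) host difference: for a bilinear `Q`, `‖Q a a − Q b b‖ ≤ ‖Q‖·(‖a‖ + ‖b‖)·‖a − b‖` — the bend-grid slack on a pair grows LINEARLY with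
the host radius, so at the rim (`‖a‖, ‖b‖ ≈ 63/10`) a bend step costs `≈ 12.6·‖ΔQ‖` per unit pair length, which a FLAT cone absorbs only in its floor (the
kinematic half of census BEND-86 on the HM62 class). [folklore] -/
theorem norm_quad_diff_le (Q : E3 →L[ℝ] E3 →L[ℝ] E3) (a b : E3) : ‖Q a a - Q b b‖ ≤ ‖Q‖ * (‖a‖ + ‖b‖) * ‖a - b‖ := by
  have h : Q a a - Q b b = Q a (a - b) + Q (a - b) b := by
    rw [map_sub, map_sub, sub_apply]
    abel
  rw [h]
  have h1 : ‖Q a (a - b)‖ ≤ ‖Q‖ * ‖a‖ * ‖a - b‖ :=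
    ((Q a).le_opNorm (a - b)).trans (mul_le_mul_of_nonneg_right (Q.le_opNorm a) (norm_nonneg _))
  have h2 : ‖Q (a - b) b‖ ≤ ‖Q‖ * ‖a - b‖ * ‖b‖ :=
    ((Q (a - b)).le_opNorm b).trans (mul_le_mul_of_nonneg_right (Q.le_opNorm (a - b)) (norm_nonneg _))
  calc ‖Q a (a - b) + Q (a - b) b‖ ≤ ‖Q a (a - b)‖ + ‖Q (a - b) b‖ := norm_add_le _ _
    _ ≤ ‖Q‖ * ‖a‖ * ‖a - b‖ + ‖Q‖ * ‖a - b‖ * ‖b‖ := add_le_add h1 h2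
    _ = ‖Q‖ * (‖a‖ + ‖b‖) * ‖a - b‖ := by ring

end Anatomy

/-! ## §5. Toy: the basin criterion DISC-87 -/

/-- ★ THE BASIN CRITERION.  A self-improving bound `B ↦ A + c·B²` (exterior/harmonic floor `A > 0`, anharmonic Taylor coefficient `c > 0` — the shape of
every constant-tracking closure of the intrinsic law) has a fixed point iff `4·A·c ≤ 1`; the census test DISC-87 reads `A` and `c` off KERNEL-86.  [folklore] -/
theorem basin_iff_disc {A c : ℝ} (hc : 0 < c) : (∃ B : ℝ, A + c * B ^ 2 ≤ B) ↔ 4 * A * c ≤ 1 := by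
  constructor
  · rintro ⟨B, hB⟩
    nlinarith [sq_nonneg (2 * c * B - 1), mul_le_mul_of_nonneg_left hB (by positivity : (0 : ℝ) ≤ 4 * c)]
  · intro h
    refine ⟨1 / (2 * c), ?_⟩
    have hc2 : (0 : ℝ) < 2 * c := by positivity
    rw [div_pow, ← sub_nonneg]
    have key : 1 / (2 * c) - (A + c * (1 ^ 2 / (2 * c) ^ 2)) = (1 - 4 * A * c) / (4 * c) := by
      field_simp
      ring
    rw [key]
    exact div_nonneg (by linarith) (by positivity)

/-- … and when it has one, every start `B₀` between the two roots is improved: `A + c·B₀² ≤ B₀` iff `B₀` lies in the root interval — in particular the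
KINEMATIC start `2τ₀` is improved only if `A + 4c·τ₀² ≤ 2τ₀` (at `τ₀ = 1/25`: `c ≤ (2/25 − A)·625/4 < 12.5`, against the Taylor value `c ≳ 10²` of BASIN-87).
[formal bookkeeping] -/
theorem start_improves_iff {A c B₀ : ℝ} : A + c * B₀ ^ 2 ≤ B₀ ↔ c * B₀ ^ 2 - B₀ + A ≤ 0 := by
  constructor <;> intro h <;> linarith

end Summit.AtomisticToContinuum.Crystallization.Theorems.FrustratedLawDichotomyStrainedPatchConeAnatomy
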